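import Mathlib
import Summits.Ventures.HodgeRepro2.T5RecordDifferentTower
import Summits.Ventures.HodgeRepro2.T5RecordSatakeEveryCMField

/-!
# THE RECORD'S LOCAL DATA OUTSIDE `4d · disc K⁺`, FOR EVERY CM FIELD: UNRAMIFIED OVER `ℚ`, COMMUTATIVE, `k[X]`

Tier-5 support N3 / §G-N4.2 (seat p3, gen 83). §N3.10.3's finiteness argument has four clauses at a place `v` of
`K⁺` outside a finite set: (u1) `E_v/F_v` unramified and `p ≠ 2`; (u2) the additive character `ψ_v` has conductor
`𝒪_v`; (u3)/(u4) the global lattices are self-dual at `v`. Files 313–319 put (u1) and (u3)/(u4) in kernel with the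
explicit set `{v ∣ 4d}`; file 320 puts the number-theoretic half of (u2) — `v` unramified over `ℚ`, i.e. `v ∤
𝔇_{K⁺/ℚ}`, i.e. `e(v/p) = 1` — in kernel with the explicit set `{v ∣ disc K⁺}`. This file joins them:

* **`discr_notMem_of_not_dvd`** — at a place `v ∣ p` with `p ∤ disc K⁺`, `disc K⁺ ∉ v`;
* **`ramificationIdx_int_eq_one_of_liesOver_of_not_dvd`** — `e(v/p) = 1` at every place `v` of `K⁺` above a rational
  prime `p ∤ disc K⁺`;
* **`not_dvd_differentIdeal_int_of_liesOver`** / **`ramificationIdx_int_eq_one_of_liesOver`** — every prime `w` of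
  `K` above a place `v` with `4d ∉ v` and `disc K⁺ ∉ v` is prime to `𝔇_{K/ℚ}` and unramified over `ℚ`;
* **`record_unramified_every_cm_field`** — THE CONSUMER STATEMENT: for every CM field `K` and every integral
  unimodular hermitian `H` there is `d ≠ 0` in `𝓞_{K⁺}` such that the places of `K⁺` dividing `4d` or `disc K⁺`
  form a finite set `S`, and at every `v ∉ S`: `e(v/p) = 1` (the kernel half of (u2)); every `w ∣ v` is prime to
  `𝔇_{K/ℚ}` with `e(w/p) = 1`; `H(U(1 ⊗ H), K_v)` is commutative; and, when one prime of `K` lies above `v`, the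
  algebra is `k[X]` and the Satake chain holds with numerals `q = p^{f(v/p)}`;
* **`notMem_of_not_dvd_norm`** — `y ∉ v` at every place `v ∣ p` with `p ∤ N_{F/ℚ}(y)` (Mathlib's
  `norm_mem_relNorm` and `relNorm_le_comap`); **`record_unramified_outside_integer`** — the same conclusions in
  MVW's form: there is an integer `N = N_{K⁺/ℚ}(4d) · disc K⁺ ≠ 0` such that they hold at EVERY place of `K⁺`
  above EVERY rational prime `p ∤ N`.

What stays print for (u2): that the conductor of `ψ_v = ψ_p ∘ Tr_{K⁺_v/ℚ_p}` is the inverse different of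
`K⁺_v/ℚ_p` (no additive characters of local fields in the tree).

§8(d): uses an L-value-free non-vanishing device: NO.
-/

open Matrix NumberField NumberField.IsCMField IsDedekindDomain IsDedekindDomain.HeightOneSpectrum Module Polynomial
  Ideal
open scoped TensorProduct Pointwise
open Summit.Ventures.HodgeRepro2.T5UnitaryGroupForm Summit.Ventures.HodgeRepro2.T5UnitaryHeckeAdjoint
  Summit.Ventures.HodgeRepro2.T5HeckePermutationModule Summit.Ventures.HodgeRepro2.T5HeckeDoubleCoset
  Summit.Ventures.HodgeRepro2.T5RecordHyperspecial Summit.Ventures.HodgeRepro2.T5GlobalLatticeAlmostAll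
  Summit.Ventures.HodgeRepro2.T5FinitePlaceSplitClassification Summit.Ventures.HodgeRepro2.T5RecordSatakeIntrinsic
  Summit.Ventures.HodgeRepro2.T5SplitPlaceUnitaryGroup Summit.Ventures.HodgeRepro2.T5NonSplitPlaceUnitaryGroup
  Summit.Ventures.HodgeRepro2.T5FinitePlaceCM Summit.Ventures.HodgeRepro2.T5StarOfInvolution
  Summit.Ventures.HodgeRepro2.T5CyclotomicSubfieldHeckeCommutative
  Summit.Ventures.HodgeRepro2.T5IntegralGramBadSet Summit.Ventures.HodgeRepro2.T5RecordSatakeDifferent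
  Summit.Ventures.HodgeRepro2.T5CMFieldSquareDatum Summit.Ventures.HodgeRepro2.T5RecordSatakeDifferentDatum
  Summit.Ventures.HodgeRepro2.T5RecordSatakeDifferentSummary Summit.Ventures.HodgeRepro2.T5RecordSatakeDifferentChain
  Summit.Ventures.HodgeRepro2.T5CyclotomicTwentyOneSatake Summit.Ventures.HodgeRepro2.T5CyclotomicSevenHeckeCommutative
  Summit.Ventures.HodgeRepro2.T5RecordDifferentTower

namespace Summit.Ventures.HodgeRepro2.T5RecordUnramifiedEveryCMField

section RationalPrime

variable (F : Type*) [Field F] [NumberField F]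
variable (p : ℕ)
variable (v : HeightOneSpectrum (𝓞 F)) [hv : v.asIdeal.LiesOver (span {(p : ℤ)})]

include hv in
/-- **`disc F ∉ v` at every place `v` above a rational prime `p ∤ disc F`**: `v ∩ ℤ = pℤ`. -/
theorem discr_notMem_of_not_dvd (h : ¬ (p : ℤ) ∣ discr F) : ((discr F : ℤ) : 𝓞 F) ∉ v.asIdeal := by
  intro hmem
  have hunder : (discr F : ℤ) ∈ v.asIdeal.under ℤ := by
    rw [Ideal.under, Ideal.mem_comap, algebraMap_int_eq, eq_intCast]
    exact hmem
  rw [← hv.over] at hunder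
  exact h (Ideal.mem_span_singleton.mp hunder)

include hv in
/-- **`e(v/p) = 1` at every place above a rational prime `p ∤ disc F`** («unramified outside the discriminant», file
320). -/
theorem ramificationIdx_int_eq_one_of_liesOver_of_not_dvd (h : ¬ (p : ℤ) ∣ discr F) :
    v.asIdeal.ramificationIdx ℤ = 1 :=
  T5RecordDifferentTower.ramificationIdx_int_eq_one_of_discr_notMem F v (discr_notMem_of_not_dvd F p v h)

include hv in
/-- `v ∤ 𝔇_{F/ℚ}` at every place above a rational prime `p ∤ disc F`. -/
theorem not_dvd_differentIdeal_int_of_liesOver_of_not_dvd (h : ¬ (p : ℤ) ∣ discr F) :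
    ¬ v.asIdeal ∣ differentIdeal ℤ (𝓞 F) :=
  T5RecordDifferentTower.not_dvd_differentIdeal_int_of_discr_notMem F v (discr_notMem_of_not_dvd F p v h)

end RationalPrime

section Places

variable (K : Type*) [Field K] [NumberField K] [IsCMField K]
variable (d : 𝓞 (maximalRealSubfield K)) (x : 𝓞 K)
  (hdx : algebraMap (maximalRealSubfield K) K (algebraMap (𝓞 (maximalRealSubfield K)) (maximalRealSubfield K) d) =
    (algebraMap (𝓞 K) K x) ^ 2)
  (hx : complexConj K (algebraMap (𝓞 K) K x) ≠ algebraMap (𝓞 K) K x)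
variable (v : HeightOneSpectrum (𝓞 (maximalRealSubfield K)))

include hdx hx in
/-- **Every prime `w` of `K` above a place `v` of `K⁺` with `4d ∉ v` and `disc K⁺ ∉ v` is prime to the absolute
different `𝔇_{K/ℚ}`** (file 315: `w ∤ 𝔇_{K/K⁺}`; file 320: `v ∤ 𝔇_{K⁺/ℚ}` and the tower). -/
theorem not_dvd_differentIdeal_int_of_liesOver (w : HeightOneSpectrum (𝓞 K)) [hw : w.asIdeal.LiesOver v.asIdeal]
    (hvd : 4 * d ∉ v.asIdeal)
    (hvD : ((discr (maximalRealSubfield K) : ℤ) : 𝓞 (maximalRealSubfield K)) ∉ v.asIdeal) :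
    ¬ w.asIdeal ∣ differentIdeal ℤ (𝓞 K) := by
  refine T5RecordDifferentTower.not_dvd_differentIdeal_int_of K w ?_ ?_
  · exact not_dvd_differentIdeal_of_notMem K d x hdx hx w (by rw [← hw.over]; exact hvd)
  · rw [← hw.over]
    exact T5RecordDifferentTower.not_dvd_differentIdeal_int_of_discr_notMem (maximalRealSubfield K) v hvD

include hdx hx in
/-- **`e(w/p) = 1` for every such `w`.** -/
theorem ramificationIdx_int_eq_one_of_liesOver (w : HeightOneSpectrum (𝓞 K)) [w.asIdeal.LiesOver v.asIdeal]
    (hvd : 4 * d ∉ v.asIdeal)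
    (hvD : ((discr (maximalRealSubfield K) : ℤ) : 𝓞 (maximalRealSubfield K)) ∉ v.asIdeal) :
    w.asIdeal.ramificationIdx ℤ = 1 :=
  T5RecordDifferentTower.ramificationIdx_int_eq_one_of_not_dvd K w
    (not_dvd_differentIdeal_int_of_liesOver K d x hdx hx v w hvd hvD)

omit [IsCMField K] in
/-- **The places of `K⁺` dividing `4d` or `disc K⁺` form a finite set** (files 315 and 320). -/
theorem finite_setOf_four_mul_mem_or_discr_mem (hd : d ≠ 0) :
    {v : HeightOneSpectrum (𝓞 (maximalRealSubfield K)) | 4 * d ∈ v.asIdeal ∨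
      ((discr (maximalRealSubfield K) : ℤ) : 𝓞 (maximalRealSubfield K)) ∈ v.asIdeal}.Finite := by
  have h := (finite_setOf_four_mul_mem K d hd).union
    (T5RecordDifferentTower.finite_setOf_discr_mem (maximalRealSubfield K))
  refine h.subset fun v hv => ?_
  rcases hv with hv | hv
  · exact Or.inl hv
  · exact Or.inr hv

end Places

section Integer

variable (F : Type*) [Field F] [NumberField F]

/-- **`y ∈ v ⇒ N_{F/ℚ}(y) ∈ v ∩ ℤ`** (Mathlib's `Ideal.norm_mem_relNorm` and `Ideal.relNorm_le_comap`). -/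
theorem norm_mem_under_of_mem (v : HeightOneSpectrum (𝓞 F)) {y : 𝓞 F} (hy : y ∈ v.asIdeal) :
    Algebra.norm ℤ y ∈ v.asIdeal.under ℤ :=
  Ideal.relNorm_le_comap ℤ v.asIdeal (Ideal.norm_mem_relNorm ℤ v.asIdeal hy)

/-- **`y ∉ v` at every place `v` above `p` with `p ∤ N_{F/ℚ}(y)`.** -/
theorem notMem_of_not_dvd_norm (p : ℕ) (v : HeightOneSpectrum (𝓞 F)) [hv : v.asIdeal.LiesOver (span {(p : ℤ)})]
    (y : 𝓞 F) (h : ¬ (p : ℤ) ∣ Algebra.norm ℤ y) : y ∉ v.asIdeal := by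
  intro hy
  have hunder := norm_mem_under_of_mem F v hy
  rw [← hv.over] at hunder
  exact h (Ideal.mem_span_singleton.mp hunder)

/-- `N_{F/ℚ}(y) ≠ 0` for `y ≠ 0` (Mathlib's `Algebra.norm_eq_zero_iff`, `𝓞_F` free of finite rank over `ℤ`). -/
theorem norm_ne_zero {y : 𝓞 F} (hy : y ≠ 0) : Algebra.norm ℤ y ≠ 0 :=
  fun h => hy (Algebra.norm_eq_zero_iff.mp h)

end Integer

section Consumer

variable (K : Type*) [Field K] [NumberField K] [IsCMField K]
variable {r : ℕ} (l : Fin r → 𝓞 K) (k : Type*) [Field k] [CharZero k]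
  (hl : Submodule.span (𝓞 (maximalRealSubfield K)) (Set.range l) = ⊤)
variable (M : Matrix (Fin 3) (Fin 3) (𝓞 K)) (hM : IsUnit M.det)
  (hH : ((algebraMap (𝓞 K) K).mapMatrix M).IsHermitian)

include hl hM hH in
/-- **THE RECORD'S LOCAL DATA OUTSIDE `4d · disc K⁺`, FOR EVERY CM FIELD**: for every CM field `K`, every generator
family `l`, every field `k` of characteristic `0` and every integral unimodular hermitian `H = M.map ι`, there is
`d ≠ 0` in `𝓞_{K⁺}` such that (i) the places of `K⁺` dividing `4d` or `disc K⁺` are finitely many; (ii) at every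
other place `v`: `e(v/p) = 1` — the kernel half of clause (u2); every prime `w` of `K` above `v` is prime to
`𝔇_{K/ℚ}` and has `e(w/p) = 1`; `H(U(1 ⊗ H), K_v)` is commutative; and if one prime of `K` lies above `v`, lying
over the rational prime `p`, the algebra is `k[X]` and the Satake chain holds with numerals `q = p^{f(v/p)}`. -/
theorem record_unramified_every_cm_field :
    ∃ d : 𝓞 (maximalRealSubfield K), d ≠ 0 ∧
      {v : HeightOneSpectrum (𝓞 (maximalRealSubfield K)) | 4 * d ∈ v.asIdeal ∨
        ((discr (maximalRealSubfield K) : ℤ) : 𝓞 (maximalRealSubfield K)) ∈ v.asIdeal}.Finite ∧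
      ∀ v : HeightOneSpectrum (𝓞 (maximalRealSubfield K)), 4 * d ∉ v.asIdeal →
        ((discr (maximalRealSubfield K) : ℤ) : 𝓞 (maximalRealSubfield K)) ∉ v.asIdeal →
        v.asIdeal.ramificationIdx ℤ = 1 ∧
        (∀ w : HeightOneSpectrum (𝓞 K), w.asIdeal.LiesOver v.asIdeal →
          ¬ w.asIdeal ∣ differentIdeal ℤ (𝓞 K) ∧ w.asIdeal.ramificationIdx ℤ = 1) ∧
        RecordCommutative K v l k ((algebraMap (𝓞 K) K).mapMatrix M) ∧
        ((v.asIdeal.primesOver (𝓞 K)).ncard = 1 →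
          RecordPolynomial K v l k ((algebraMap (𝓞 K) K).mapMatrix M) ∧
          ∀ (p : ℕ) [Fact p.Prime] [v.asIdeal.LiesOver (span {(p : ℤ)})],
            ChainNumerals K v l k ((algebraMap (𝓞 K) K).mapMatrix M) (p ^ v.asIdeal.inertiaDeg ℤ)
              ((p ^ v.asIdeal.inertiaDeg ℤ) ^ 3 + 1) ((p ^ v.asIdeal.inertiaDeg ℤ) ^ 4)
              ((p ^ v.asIdeal.inertiaDeg ℤ) ^ 4 + p ^ v.asIdeal.inertiaDeg ℤ)) := by
  obtain ⟨d, x, hdx, hx, hd⟩ := exists_integer_datum_ne_zero K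
  refine ⟨d, hd, finite_setOf_four_mul_mem_or_discr_mem K d hd, fun v hvd hvD => ⟨?_, fun w hw => ?_, ?_,
    fun h1 => ⟨?_, fun p _ _ => ?_⟩⟩⟩
  · exact T5RecordDifferentTower.ramificationIdx_int_eq_one_of_discr_notMem (maximalRealSubfield K) v hvD
  · haveI := hw
    exact ⟨not_dvd_differentIdeal_int_of_liesOver K d x hdx hx v w hvd hvD,
      ramificationIdx_int_eq_one_of_liesOver K d x hdx hx v w hvd hvD⟩
  · exact recordCommutative_of_four_mul_notMem K d x hdx hx v l k hl hvd hH (isUnit_det_mapMatrix M hM)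
      (forall_notMem_badSet_mapMatrix v M hM)
  · exact recordPolynomial_of_four_mul_notMem_integral K d x hdx hx v l k hl hvd h1 M hM hH
  · exact chainNumerals_of_four_mul_notMem_integral K d x hdx hx p v hvd h1 l k hl M hM hH

include hl hM hH in
/-- **THE SAME IN MVW'S FORM — OUTSIDE THE PRIMES DIVIDING ONE INTEGER**: there is an integer `N ≠ 0` (namely
`N_{K⁺/ℚ}(4d) · disc K⁺`) such that at every place `v` of `K⁺` above every rational prime `p ∤ N`: `e(v/p) = 1`;
every prime `w` of `K` above `v` is prime to `𝔇_{K/ℚ}` with `e(w/p) = 1`; `H(U(1 ⊗ H), K_v)` is commutative; and if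
one prime of `K` lies above `v`, the algebra is `k[X]` and the Satake chain holds with numerals `q = p^{f(v/p)}`. -/
theorem record_unramified_outside_integer :
    ∃ N : ℤ, N ≠ 0 ∧
      ∀ (p : ℕ), ¬ (p : ℤ) ∣ N →
      ∀ v : HeightOneSpectrum (𝓞 (maximalRealSubfield K)), v.asIdeal.LiesOver (span {(p : ℤ)}) →
        v.asIdeal.ramificationIdx ℤ = 1 ∧
        (∀ w : HeightOneSpectrum (𝓞 K), w.asIdeal.LiesOver v.asIdeal →
          ¬ w.asIdeal ∣ differentIdeal ℤ (𝓞 K) ∧ w.asIdeal.ramificationIdx ℤ = 1) ∧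
        RecordCommutative K v l k ((algebraMap (𝓞 K) K).mapMatrix M) ∧
        ((v.asIdeal.primesOver (𝓞 K)).ncard = 1 →
          RecordPolynomial K v l k ((algebraMap (𝓞 K) K).mapMatrix M) ∧
          ∀ [Fact p.Prime],
            ChainNumerals K v l k ((algebraMap (𝓞 K) K).mapMatrix M) (p ^ v.asIdeal.inertiaDeg ℤ)
              ((p ^ v.asIdeal.inertiaDeg ℤ) ^ 3 + 1) ((p ^ v.asIdeal.inertiaDeg ℤ) ^ 4)
              ((p ^ v.asIdeal.inertiaDeg ℤ) ^ 4 + p ^ v.asIdeal.inertiaDeg ℤ)) := by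
  obtain ⟨d, hd, -, hmain⟩ := record_unramified_every_cm_field K l k hl M hM hH
  refine ⟨Algebra.norm ℤ (4 * d) * discr (maximalRealSubfield K),
    mul_ne_zero (norm_ne_zero (maximalRealSubfield K) (mul_ne_zero (by norm_num) hd))
      (discr_ne_zero (maximalRealSubfield K)), fun p hp v hv => ?_⟩
  haveI := hv
  have hvd : 4 * d ∉ v.asIdeal :=
    notMem_of_not_dvd_norm (maximalRealSubfield K) p v (4 * d) fun h => hp (Dvd.dvd.mul_right h _)
  have hvD : ((discr (maximalRealSubfield K) : ℤ) : 𝓞 (maximalRealSubfield K)) ∉ v.asIdeal :=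
    discr_notMem_of_not_dvd (maximalRealSubfield K) p v fun h => hp (Dvd.dvd.mul_left h _)
  obtain ⟨h1, h2, h3, h4⟩ := hmain v hvd hvD
  exact ⟨h1, h2, h3, fun hone => ⟨(h4 hone).1, (h4 hone).2 p⟩⟩

end Consumer

end Summit.Ventures.HodgeRepro2.T5RecordUnramifiedEveryCMField
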